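import Summits.AtomisticToContinuum.HydrodynamicLimit.Theses.ImplosionDichotomy
import Literature.MathematicalPhysics.KineticTheory.HardSphereEuler
import Literature.Analysis.FluidPDE.MVWeakStrongUniqueness
import Literature.Analysis.FluidPDE.CompressibleEulerWellPosedness
import Literature.Analysis.FunctionSpaces.TorusCalculusProofs
import Literature.Analysis.FunctionSpaces.TorusSpaceTime
import Mathlib.Analysis.Calculus.BumpFunction.InnerProduct

/-!
# Local well-posedness of the hard-sphere Euler system below a packing threshold
# (line `r2-one-mode-two-conditions`, stub `stub_wellPosedness`, conditional form)

Crux `Summit.AtomisticToContinuum.HydrodynamicLimit.Theses.ImplosionDichotomy.DenseExcursion`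
(stmt-AtomisticToContinuum-12586), line `r2-one-mode-two-conditions`
(`Cruxes/DenseExcursion/Lines/r2-one-mode-two-conditions.lean`), registered stub
`stub_wellPosedness : HsEulerWellPosedness` (skeleton §0, copied verbatim below): local existence and `C¹`
continuation of classical solutions of the hard-sphere compressible Euler system
`IsHardSphereEulerSolution σ` (pressure `p = ρ θ Z(ρσ³)`, `Z = hsCompressibility`, energy `e = 3θ/2`) below a
packing threshold `η₁` on which `Z` is smooth.

This is generic symmetric-hyperbolic PDE theory (Kato 1975, Majda 1984), none of which is in the tree or in
Mathlib (no Sobolev `H^s` theory of quasi-linear hyperbolic systems). Following the line lead's brief the file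

* uses the published theorem, stated ONCE in the tree's vocabulary as the named fact
  `Literature.Analysis.FluidPDE.CompressibleEulerLocalWellPosedness` (filed from this seat, p78549; Majda 1984, Ch. 2, Thms 2.1–2.2 with their `H^s_{uℓ}` annex,
  specialised to the complete Euler system of a monatomic fluid with an athermal pressure law `p = ρ θ ζ(ρ)`,
  `e = 3θ/2` — the equation of state `CompressibleEuler.EulerEOS.monatomicExcess ζ f` of
  `DissipativeMVEuler.lean`, classical solutions `CompressibleEuler.IsClassicalEulerSolution` of
  `MVWeakStrongUniqueness.lean`, which is `IsHardSphereEulerSolution` field for field with `hsPressure σ`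
  replaced by `eos.p` — on the hyperbolicity range `(ρ ζ)′ > 0`);
* proves the BRIDGE between the two solution notions (`isHardSphereEulerSolution_iff_classical`): as long as
  the packing `ρσ³` stays in `[0, η₀]`, where `hsCompressibility = Z` for a smooth `Z`, a triple of fields is a
  hard-sphere solution iff it is a classical solution for `monatomicExcess (fun r => Z (r σ³)) f` — the two
  pressure FIELDS coincide as functions on the torus at each time, so their torus gradients and the energy
  fluxes agree; no regularity of the (`deriv`-junk) `hsCompressibility` outside `[0, η₀]` is used;
* proves `stub_wellPosedness_of : CompressibleEulerLocalWellPosedness → HsEulerWellPosedness`: given `η₀` and `Z`,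
  take `η₁ ≤ η₀` with `Z(η) + η Z′(η) > 0` on `[0, η₁]` (`Z 0 = hsCompressibility 0 = 1` and continuity), and for
  each `σ > 0` apply the fact to `ζ ρ = Z(ρσ³)` on the density range `(0, η₁/σ³)`
  (`(ρζ)′(ρ) = Z(η) + ηZ′(η)` at `η = ρσ³`).

The registered (unconditional) signature `stub_wellPosedness : HsEulerWellPosedness` therefore holds modulo the
named fact; discharging `CompressibleEulerLocalWellPosedness` is Literature debt (Kato/Majda in Lean). §5 records
that the hypothesis of `HsEulerWellPosedness` is met under the route item `HsEosLowDensity` (analytic free energy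
⟹ a globally smooth `Z` agreeing with `hsCompressibility` on some `[0, η₀]`, by a bump-function globalisation),
which is how `stub_tunedForcedImplosion` consumes it.
-/

noncomputable section

open Set Filter Topology
open scoped ContDiff

namespace Summit.AtomisticToContinuum.HydrodynamicLimit.Theorems.R2OneModeTwoConditions

open Literature.MathematicalPhysics.KineticTheory
open Literature.Analysis.FunctionSpaces
open Literature.Analysis.FluidPDE.CompressibleEuler (EulerEOS IsClassicalEulerSolution)

/-! ## §0 The registered statement (verbatim from the line skeleton) -/

/-- LOCAL WELL-POSEDNESS WITH `C¹` CONTINUATION for the hard-sphere Euler system below a packing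
threshold on which the compressibility factor `Z = hsCompressibility` is smooth (Kato 1975 / Majda 1984
for the symmetric-hyperbolic system `p = ρ θ Z(ρ σ³)`): given `η₀ > 0` with `Z` smooth on `[0, η₀]`,
there is `η₁ ∈ (0, η₀]` such that (i) smooth positive data of packing `< η₁` launch a classical solution
on some `[0, T)`, `T > 0`; (ii) a classical solution on `[0, T)` with packing `≤ η₁/2`, density and
temperature in `[M⁻¹, M]`-type bounds and uniformly bounded first space derivatives extends classically
beyond `T`. -/
def HsEulerWellPosedness : Prop :=
  ∀ η₀ : ℝ, 0 < η₀ →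
    (∃ Z : ℝ → ℝ, ContDiff ℝ ∞ Z ∧ Set.EqOn hsCompressibility Z (Set.Icc 0 η₀)) →
    ∃ η₁ : ℝ, 0 < η₁ ∧ η₁ ≤ η₀ ∧
      (∀ σ : ℝ, 0 < σ → ∀ (ρ₀ θ₀ : T3 → ℝ) (u₀ : T3 → V3),
        Literature.Analysis.FunctionSpaces.Torus.IsSmooth ρ₀ →
        Literature.Analysis.FunctionSpaces.Torus.IsSmooth θ₀ →
        Literature.Analysis.FunctionSpaces.Torus.IsSmooth u₀ →
        (∀ x, 0 < ρ₀ x) → (∀ x, 0 < θ₀ x) → (∀ x, ρ₀ x * σ ^ 3 < η₁) →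
        ∃ T : ℝ, 0 < T ∧ ∃ (ρ θ : ℝ → T3 → ℝ) (u : ℝ → T3 → V3),
          IsHardSphereEulerSolution σ T ρ u θ ∧ ρ 0 = ρ₀ ∧ u 0 = u₀ ∧ θ 0 = θ₀) ∧
      (∀ σ : ℝ, 0 < σ → ∀ T : ℝ, 0 < T → ∀ (ρ θ : ℝ → T3 → ℝ) (u : ℝ → T3 → V3),
        IsHardSphereEulerSolution σ T ρ u θ →
        (∃ M : ℝ, ∀ t ∈ Set.Ico 0 T, ∀ x, ρ t x * σ ^ 3 ≤ η₁ / 2 ∧ M⁻¹ ≤ ρ t x ∧ M⁻¹ ≤ θ t x ∧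
            θ t x ≤ M ∧ ‖u t x‖ ≤ M ∧
            ‖Literature.Analysis.FunctionSpaces.Torus.fderiv (ρ t) x‖ ≤ M ∧
            ‖Literature.Analysis.FunctionSpaces.Torus.fderiv (u t) x‖ ≤ M ∧
            ‖Literature.Analysis.FunctionSpaces.Torus.fderiv (θ t) x‖ ≤ M) →
        ∃ T₂ : ℝ, T < T₂ ∧ ∃ (ρ' θ' : ℝ → T3 → ℝ) (u' : ℝ → T3 → V3),
          IsHardSphereEulerSolution σ T₂ ρ' u' θ' ∧ ∀ t ∈ Set.Ico 0 T, ρ' t = ρ t ∧ u' t = u t ∧ θ' t = θ t)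

/-! ## §1 The published theorem

The named fact `Literature.Analysis.FluidPDE.CompressibleEulerLocalWellPosedness` (Majda 1984, Ch. 2,
Thms 2.1–2.2: local existence and sharp continuation for the complete Euler system of a monatomic fluid with an
athermal pressure law `p = ρ θ ζ(ρ)`, `e = 3θ/2`, on the hyperbolicity range `(ρζ)′ > 0`, in the vocabulary
`CompressibleEuler.IsClassicalEulerSolution (EulerEOS.monatomicExcess ζ f)`) was filed from this seat and lives in
`Literature/Analysis/FluidPDE/CompressibleEulerWellPosedness.lean` (p78549). -/

/-! ## §2 The bridge: hard-sphere solutions are classical `monatomicExcess` solutions below the threshold -/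

section Bridge

variable {Z : ℝ → ℝ} {η₀ σ : ℝ}

/-- Below the threshold the two pressure laws give THE SAME pressure field: if `hsCompressibility = Z` on
`[0, η₀]` and the packing `ρ σ³` of the slice lies in `[0, η₀]` everywhere, then
`y ↦ (monatomicExcess (fun r => Z (r σ³)) f).p (ρ y) (θ y) = ρ θ Z(ρσ³)` equals `y ↦ hsPressure σ (ρ y) (θ y)`. -/
theorem pressureField_eq (f : ℝ → ℝ) (hEq : Set.EqOn hsCompressibility Z (Set.Icc 0 η₀))
    {ρ θ : T3 → ℝ} (hρ : ∀ y, ρ y * σ ^ 3 ∈ Set.Icc 0 η₀) :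
    (fun y => (EulerEOS.monatomicExcess (fun r => Z (r * σ ^ 3)) f).p (ρ y) (θ y)) =
      fun y => hsPressure σ (ρ y) (θ y) := by
  funext y
  show ρ y * θ y * Z (ρ y * σ ^ 3) = ρ y * θ y * hsCompressibility (ρ y * σ ^ 3)
  rw [hEq (hρ y)]

/-- The two total energy densities agree identically (`e = 3θ/2` in both). -/
theorem energyField_eq (f : ℝ → ℝ) (ρ θ : ℝ → T3 → ℝ) (u : ℝ → T3 → V3) :
    (fun s y => ρ s y * (‖u s y‖ ^ 2 / 2 + (EulerEOS.monatomicExcess (fun r => Z (r * σ ^ 3)) f).e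
        (ρ s y) (θ s y))) = fun s y => totalEnergyDensity (ρ s y) (u s y) (θ s y) := by
  rfl

/-- Below the threshold the two energy-flux fields `(E + p) u` agree. -/
theorem energyFlux_eq (f : ℝ → ℝ) (hEq : Set.EqOn hsCompressibility Z (Set.Icc 0 η₀))
    {ρ θ : T3 → ℝ} (u : T3 → V3) (hρ : ∀ y, ρ y * σ ^ 3 ∈ Set.Icc 0 η₀) :
    (fun y => (ρ y * (‖u y‖ ^ 2 / 2 + (EulerEOS.monatomicExcess (fun r => Z (r * σ ^ 3)) f).e (ρ y) (θ y)) +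
        (EulerEOS.monatomicExcess (fun r => Z (r * σ ^ 3)) f).p (ρ y) (θ y)) • u y) =
      fun y => (totalEnergyDensity (ρ y) (u y) (θ y) + hsPressure σ (ρ y) (θ y)) • u y := by
  funext y
  show (ρ y * (‖u y‖ ^ 2 / 2 + 3 / 2 * θ y) + ρ y * θ y * Z (ρ y * σ ^ 3)) • u y =
    (ρ y * (‖u y‖ ^ 2 / 2 + 3 / 2 * θ y) + ρ y * θ y * hsCompressibility (ρ y * σ ^ 3)) • u y
  rw [hEq (hρ y)]

/-- **Bridge.** If `hsCompressibility = Z` on `[0, η₀]` and the packing `ρ σ³` of the fields stays in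
`[0, η₀]` on `[0, T) × 𝕋³`, then `(ρ, u, θ)` is a classical hard-sphere Euler solution at reduced diameter
`σ` on `[0, T)` iff it is a classical solution of the complete Euler system for the equation of state
`monatomicExcess (fun r => Z (r σ³)) f` (any excess free energy `f`: the entropy does not enter). The two
structures agree field for field once the pressure fields are identified (`pressureField_eq`). -/
theorem isHardSphereEulerSolution_iff_classical (f : ℝ → ℝ)
    (hEq : Set.EqOn hsCompressibility Z (Set.Icc 0 η₀)) {T : ℝ} {ρ θ : ℝ → T3 → ℝ} {u : ℝ → T3 → V3}
    (hρ : ∀ t ∈ Set.Ico 0 T, ∀ y, ρ t y * σ ^ 3 ∈ Set.Icc 0 η₀) :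
    IsHardSphereEulerSolution σ T ρ u θ ↔
      IsClassicalEulerSolution (EulerEOS.monatomicExcess (fun r => Z (r * σ ^ 3)) f) T ρ u θ := by
  constructor
  · intro h
    refine ⟨h.smooth_density, h.smooth_velocity, h.smooth_temperature, h.density_pos,
      h.temperature_pos, h.mass, fun t ht x => ?_, fun t ht x => ?_⟩
    · rw [pressureField_eq f hEq (hρ t ht)]
      exact h.momentum t ht x
    · rw [energyField_eq f ρ θ u, energyFlux_eq f hEq (u t) (hρ t ht)]
      exact h.energy t ht x
  · intro h
    refine ⟨h.smooth_density, h.smooth_velocity, h.smooth_temperature, h.density_pos,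
      h.temperature_pos, h.mass, fun t ht x => ?_, fun t ht x => ?_⟩
    · rw [← pressureField_eq f hEq (hρ t ht)]
      exact h.momentum t ht x
    · rw [← energyField_eq (Z := Z) (σ := σ) f ρ θ u, ← energyFlux_eq f hEq (u t) (hρ t ht)]
      exact h.energy t ht x

end Bridge

/-! ## §3 Calculus of the compressibility factor near packing `0` -/

/-- `Z(0) = 1`: the compressibility factor of the hard-sphere gas at zero packing (no `deriv` junk enters,
the excess term carries the factor `η = 0`). -/
theorem hsCompressibility_zero : hsCompressibility 0 = 1 := by
  simp [hsCompressibility]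

/-- Chain rule for the rescaled law `ζ(ρ) = Z(ρσ³)`: `(ρ Z(ρσ³))′(r) = Z(η) + η Z′(η)` at `η = rσ³`. -/
theorem deriv_mul_rescaled {Z : ℝ → ℝ} (hZ : Differentiable ℝ Z) (σ r : ℝ) :
    deriv (fun s => s * Z (s * σ ^ 3)) r = Z (r * σ ^ 3) + r * σ ^ 3 * deriv Z (r * σ ^ 3) := by
  have h1 : HasDerivAt (fun s => s * σ ^ 3) (σ ^ 3) r := hasDerivAt_mul_const (σ ^ 3)
  have h2 : HasDerivAt (fun s => Z (s * σ ^ 3)) (deriv Z (r * σ ^ 3) * σ ^ 3) r :=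
    (hZ (r * σ ^ 3)).hasDerivAt.comp r h1
  have h3 : HasDerivAt (fun s => s * Z (s * σ ^ 3))
      (1 * Z (r * σ ^ 3) + r * (deriv Z (r * σ ^ 3) * σ ^ 3)) r :=
    (hasDerivAt_id' r).fun_mul h2
  rw [h3.deriv]
  ring

/-- For a smooth `Z` agreeing with `hsCompressibility` on `[0, η₀]`, `η₀ > 0`, there is `η₁ ∈ (0, η₀]` with
`Z(η) + η Z′(η) > 0` for all `|η| ≤ η₁` (continuity at `η = 0`, where the value is `Z(0) = 1`). -/
theorem exists_threshold {Z : ℝ → ℝ} {η₀ : ℝ} (hη₀ : 0 < η₀) (hZ : ContDiff ℝ ∞ Z)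
    (hEq : Set.EqOn hsCompressibility Z (Set.Icc 0 η₀)) :
    ∃ η₁ : ℝ, 0 < η₁ ∧ η₁ ≤ η₀ ∧ ∀ η : ℝ, |η| ≤ η₁ → 0 < Z η + η * deriv Z η := by
  have hcont : Continuous fun η => Z η + η * deriv Z η :=
    hZ.continuous.add (continuous_id.mul (hZ.continuous_deriv (by simp)))
  have h0 : Z 0 + 0 * deriv Z 0 = 1 := by
    rw [zero_mul, add_zero, ← hEq ⟨le_rfl, hη₀.le⟩, hsCompressibility_zero]
  have hopen : IsOpen {η : ℝ | 0 < Z η + η * deriv Z η} := isOpen_lt continuous_const hcont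
  have hmem : (0 : ℝ) ∈ {η : ℝ | 0 < Z η + η * deriv Z η} := by
    show 0 < Z 0 + 0 * deriv Z 0
    rw [h0]; exact one_pos
  obtain ⟨δ, hδ, hball⟩ := Metric.isOpen_iff.1 hopen 0 hmem
  refine ⟨min η₀ (δ / 2), lt_min hη₀ (half_pos hδ), min_le_left _ _, fun η hη => hball ?_⟩
  rw [Metric.mem_ball, Real.dist_eq, sub_zero]
  exact lt_of_le_of_lt (hη.trans (min_le_right _ _)) (half_lt_self hδ)

/-- For `σ > 0` and `Z(η) + ηZ′(η) > 0` on `|η| ≤ η₁`, the rescaled law `ζ(ρ) = Z(ρσ³)` is hyperbolic on the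
density range `(0, η₁/σ³)`: `(ρ ζ(ρ))′ > 0` there. -/
theorem hyperbolic_rescaled {Z : ℝ → ℝ} (hZ : ContDiff ℝ ∞ Z) {η₁ σ : ℝ} (hσ : 0 < σ)
    (hpos : ∀ η : ℝ, |η| ≤ η₁ → 0 < Z η + η * deriv Z η) :
    ∀ r ∈ Set.Ioo 0 (η₁ / σ ^ 3), 0 < deriv (fun s => s * Z (s * σ ^ 3)) r := by
  intro r hr
  have hσ3 : 0 < σ ^ 3 := pow_pos hσ 3
  rw [deriv_mul_rescaled (hZ.differentiable (by simp)) σ r]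
  refine hpos (r * σ ^ 3) ?_
  rw [abs_of_nonneg (mul_nonneg hr.1.le hσ3.le)]
  exact ((lt_div_iff₀ hσ3).1 hr.2).le

/-! ## §4 The stub, conditional on the named fact -/

/-- **`stub_wellPosedness` modulo the named fact.** Local well-posedness with `C¹` continuation for the
hard-sphere Euler system below a packing threshold on which `Z` is smooth follows from Majda's theorems for
the athermal law `p = ρ θ ζ(ρ)`: choose `η₁ ≤ η₀` with `Z(η) + ηZ′(η) > 0` on `[0, η₁]` (`exists_threshold`);
for `σ > 0` put `ζ(ρ) = Z(ρσ³)`, `ρ̄ = η₁/σ³`, so that `(ρζ)′ > 0` on `(0, ρ̄)` (`hyperbolic_rescaled`); local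
existence (i) and continuation (ii) of the fact transfer through `isHardSphereEulerSolution_iff_classical`,
the packing of all fields involved staying in `[0, η₁] ⊆ [0, η₀]`. -/
theorem stub_wellPosedness_of :
    Literature.Analysis.FluidPDE.CompressibleEulerLocalWellPosedness → HsEulerWellPosedness := by
  intro hLWP η₀ hη₀ hZex
  obtain ⟨Z, hZ, hEq⟩ := hZex
  obtain ⟨η₁, hη₁, hη₁₀, hpos⟩ := exists_threshold hη₀ hZ hEq
  refine ⟨η₁, hη₁, hη₁₀, fun σ hσ ρ₀ θ₀ u₀ hρ₀ hθ₀ hu₀ hρ₀pos hθ₀pos hpack => ?_,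
    fun σ hσ T hT ρ θ u hE hM => ?_⟩
  · -- (i) local existence
    have hσ3 : 0 < σ ^ 3 := pow_pos hσ 3
    have hζs : ContDiff ℝ ∞ (fun r => Z (r * σ ^ 3)) := hZ.comp (contDiff_id.mul contDiff_const)
    obtain ⟨hloc, -⟩ := hLWP (fun r => Z (r * σ ^ 3)) (fun _ => 0) (η₁ / σ ^ 3) hζs (div_pos hη₁ hσ3)
      (hyperbolic_rescaled hZ hσ hpos)
    have hdata : ∀ x, ρ₀ x < η₁ / σ ^ 3 := fun x => (lt_div_iff₀ hσ3).2 (hpack x)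
    obtain ⟨T, hT, ρ, θ, u, hsol, hρ0, hu0, hθ0, hlt⟩ :=
      hloc ρ₀ θ₀ u₀ hρ₀ hθ₀ hu₀ hρ₀pos hdata hθ₀pos
    have hpk : ∀ t ∈ Set.Ico 0 T, ∀ y, ρ t y * σ ^ 3 ∈ Set.Icc 0 η₀ := fun t ht y =>
      ⟨mul_nonneg (hsol.density_pos t ht y).le hσ3.le,
        (((lt_div_iff₀ hσ3).1 (hlt t ht y)).le).trans hη₁₀⟩
    exact ⟨T, hT, ρ, θ, u, (isHardSphereEulerSolution_iff_classical (fun _ => 0) hEq hpk).2 hsol,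
      hρ0, hu0, hθ0⟩
  · -- (ii) continuation
    have hσ3 : 0 < σ ^ 3 := pow_pos hσ 3
    have hζs : ContDiff ℝ ∞ (fun r => Z (r * σ ^ 3)) := hZ.comp (contDiff_id.mul contDiff_const)
    obtain ⟨-, hcont⟩ := hLWP (fun r => Z (r * σ ^ 3)) (fun _ => 0) (η₁ / σ ^ 3) hζs (div_pos hη₁ hσ3)
      (hyperbolic_rescaled hZ hσ hpos)
    obtain ⟨M, hM⟩ := hM
    have hpk : ∀ t ∈ Set.Ico 0 T, ∀ y, ρ t y * σ ^ 3 ∈ Set.Icc 0 η₀ := fun t ht y =>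
      ⟨mul_nonneg (hE.density_pos t ht y).le hσ3.le,
        (hM t ht y).1.trans ((half_le_self hη₁.le).trans hη₁₀)⟩
    have hsol : IsClassicalEulerSolution (EulerEOS.monatomicExcess (fun r => Z (r * σ ^ 3)) fun _ => 0)
        T ρ u θ :=
      (isHardSphereEulerSolution_iff_classical (fun _ => 0) hEq hpk).1 hE
    have hbounds : ∃ M' ρ₁ : ℝ, ρ₁ < η₁ / σ ^ 3 ∧ ∀ t ∈ Set.Ico 0 T, ∀ x,
        M'⁻¹ ≤ ρ t x ∧ ρ t x ≤ ρ₁ ∧ M'⁻¹ ≤ θ t x ∧ θ t x ≤ M' ∧ ‖u t x‖ ≤ M' ∧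
        ‖Torus.fderiv (ρ t) x‖ ≤ M' ∧ ‖Torus.fderiv (u t) x‖ ≤ M' ∧ ‖Torus.fderiv (θ t) x‖ ≤ M' := by
      refine ⟨M, η₁ / 2 / σ ^ 3, div_lt_div_of_pos_right (half_lt_self hη₁) hσ3, fun t ht x => ?_⟩
      obtain ⟨h1, h2, h3, h4, h5, h6, h7, h8⟩ := hM t ht x
      exact ⟨h2, (le_div_iff₀ hσ3).2 h1, h3, h4, h5, h6, h7, h8⟩
    obtain ⟨T₂, hT₂, ρ', θ', u', hsol', hagree, hlt⟩ := hcont T hT ρ θ u hsol hbounds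
    have hpk' : ∀ t ∈ Set.Ico 0 T₂, ∀ y, ρ' t y * σ ^ 3 ∈ Set.Icc 0 η₀ := fun t ht y =>
      ⟨mul_nonneg (hsol'.density_pos t ht y).le hσ3.le,
        (((lt_div_iff₀ hσ3).1 (hlt t ht y)).le).trans hη₁₀⟩
    exact ⟨T₂, hT₂, ρ', θ', u',
      (isHardSphereEulerSolution_iff_classical (fun _ => 0) hEq hpk').2 hsol', hagree⟩

/-! ## §5 Non-vacuity: the route item `HsEosLowDensity` supplies the hypothesis of `HsEulerWellPosedness` -/

section NonVacuity

/-- Smooth globalisation by a bump function: a function `C^∞` on the ball `(-R, R)` agrees on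
`[-R/2, R/2]` with a globally `C^∞` function (multiply by a `ContDiffBump` equal to `1` on the closed ball of
radius `R/2` and supported in the ball of radius `3R/4`). [folklore] -/
theorem exists_contDiff_eqOn_of_contDiffOn {g : ℝ → ℝ} {R : ℝ} (hR : 0 < R)
    (hg : ContDiffOn ℝ ∞ g (Metric.ball 0 R)) :
    ∃ G : ℝ → ℝ, ContDiff ℝ ∞ G ∧ Set.EqOn g G (Metric.closedBall 0 (R / 2)) := by
  let φ : ContDiffBump (0 : ℝ) := ⟨R / 2, 3 * R / 4, half_pos hR, by linarith⟩
  refine ⟨fun x => φ x * g x, ?_, fun x hx => ?_⟩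
  · rw [contDiff_iff_contDiffAt]
    intro x
    by_cases hx : x ∈ Metric.ball (0 : ℝ) R
    · exact φ.contDiffAt.mul (hg.contDiffAt (Metric.isOpen_ball.mem_nhds hx))
    · have hx' : φ.rOut < dist x 0 := by
        have hR' : R ≤ dist x 0 := by simpa [Metric.mem_ball, not_lt] using hx
        show 3 * R / 4 < dist x 0
        linarith
      have hev : (fun y => φ y * g y) =ᶠ[𝓝 x] fun _ => 0 := by
        have hopen : ∀ᶠ y in 𝓝 x, φ.rOut < dist y 0 :=
          (isOpen_lt continuous_const (continuous_id.dist continuous_const)).mem_nhds hx'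
        filter_upwards [hopen] with y hy
        rw [φ.zero_of_le_dist hy.le, zero_mul]
      exact contDiffAt_const.congr_of_eventuallyEq hev
  · show g x = φ x * g x
    rw [φ.one_of_mem_closedBall hx, one_mul]

/-- **Non-vacuity of the hypothesis of `HsEulerWellPosedness` under the route item `HsEosLowDensity`**:
if the hard-sphere excess free energy is real-analytic near packing `0`, there are `η₀ > 0` and a globally
smooth `Z` with `hsCompressibility = Z` on `[0, η₀]` (`Z = 1 + η F′(η)` near `[0, η₀]`; at `η = 0` both sides
are `1`, the `deriv`-junk being multiplied by `0`). -/
theorem exists_smooth_compressibility_Icc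
    (hEos : Summit.AtomisticToContinuum.HydrodynamicLimit.Theses.ImplosionDichotomy.HsEosLowDensity) :
    ∃ η₀ : ℝ, 0 < η₀ ∧ ∃ Z : ℝ → ℝ, ContDiff ℝ ∞ Z ∧ Set.EqOn hsCompressibility Z (Set.Icc 0 η₀) := by
  obtain ⟨η₀, hη₀, F, hF, hEq, -, -, -⟩ := hEos
  have hg : ContDiffOn ℝ ∞ (fun η => 1 + η * deriv F η) (Metric.ball 0 η₀) := by
    have hball : Metric.ball (0 : ℝ) η₀ = Set.Ioo (-η₀) η₀ := by
      rw [Real.ball_eq_Ioo, zero_sub, zero_add]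
    rw [hball]
    exact contDiffOn_const.add (contDiffOn_id.mul hF.deriv.contDiffOn_of_completeSpace)
  obtain ⟨G, hG, hGeq⟩ := exists_contDiff_eqOn_of_contDiffOn hη₀ hg
  refine ⟨η₀ / 2, half_pos hη₀, G, hG, fun η hη => ?_⟩
  have hηball : η ∈ Metric.closedBall (0 : ℝ) (η₀ / 2) := by
    rw [Metric.mem_closedBall, dist_zero_right, Real.norm_eq_abs, abs_of_nonneg hη.1]
    exact hη.2
  rw [← hGeq hηball]
  show 1 + η * deriv hsExcessFreeEnergy η = 1 + η * deriv F η
  rcases hη.1.eq_or_lt with h0 | hpos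
  · subst h0
    simp
  · have hlt : η < η₀ := lt_of_le_of_lt hη.2 (half_lt_self hη₀)
    have hnhds : hsExcessFreeEnergy =ᶠ[𝓝 η] F :=
      hEq.eventuallyEq_of_mem (mem_of_superset (Ioo_mem_nhds hpos hlt) Ioo_subset_Ico_self)
    rw [hnhds.deriv_eq]

end NonVacuity

end Summit.AtomisticToContinuum.HydrodynamicLimit.Theorems.R2OneModeTwoConditions

end
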